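import Summits.Ventures.HodgeRepro2.T5FinitePlaceSplitProduct

/-!
# The finite-place dichotomy of a CM field, in one statement (cell pub-hodge-repro2, seat p3)

Tier-5 N2 support, §N2.9.2 of route/T5-N2-route-3.md («completions») at the finite places — the summary of files
115–127 on Mathlib's `IsCMField K` (datum `θ = y²`, `c y ≠ y`): for every finite place `v` of `K⁺` EITHER
`v` is NON-SPLIT — exactly one prime `w` of `K` above `v`, `θ` not a `v`-adic square, `[K_w : K⁺_v] = 2`,
`K⁺_v ⊗[K⁺] K ≃ₐ[K⁺_v] K_w` (file 117) — OR `v` is SPLIT — exactly two primes `w ≠ w'`, `θ` a `v`-adic square,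
`K_w = K⁺_v = K_{w'}`, `K⁺_v ⊗[K⁺] K ≃ₐ[K⁺_v] K_w × K_{w'}` (file 127): `dichotomy`. The primes above `v` are produced
as `HeightOneSpectrum`s from `Ideal.primesOver` (`heightOneSpectrumOfPrimesOver`). Mathlib + files 115–127 only.
No display; no device. §8(d): uses an L-value-free non-vanishing device: NO.
-/

namespace Summit.Ventures.HodgeRepro2.T5FinitePlaceDichotomy

open IsDedekindDomain IsDedekindDomain.HeightOneSpectrum NumberField NumberField.IsCMField Module
open scoped Summit.Ventures.HodgeRepro2.T5FinitePlaceLiesOver TensorProduct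
open Summit.Ventures.HodgeRepro2.T5FinitePlaceLiesOver Summit.Ventures.HodgeRepro2.T5FinitePlaceQuadratic
  Summit.Ventures.HodgeRepro2.T5FinitePlaceTensorEquiv Summit.Ventures.HodgeRepro2.T5FinitePlaceCM
  Summit.Ventures.HodgeRepro2.T5FinitePlaceCMDecomp Summit.Ventures.HodgeRepro2.T5FinitePlaceSplitIff
  Summit.Ventures.HodgeRepro2.T5FinitePlaceSplitProduct

section PrimesOver

variable {K : Type*} [Field K] [NumberField K]
variable (v : HeightOneSpectrum (𝓞 (maximalRealSubfield K)))

/-- A prime of `𝓞_K` above `v` is a height-one prime (it is nonzero, since `v` is). -/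
noncomputable def heightOneSpectrumOfPrimesOver (P : Ideal (𝓞 K)) (hP : P ∈ v.asIdeal.primesOver (𝓞 K)) :
    HeightOneSpectrum (𝓞 K) :=
  haveI := hP.2
  ⟨P, hP.1, Ideal.ne_bot_of_liesOver_of_ne_bot v.ne_bot P⟩

omit [NumberField K] in
/-- `heightOneSpectrumOfPrimesOver` has the given ideal. -/
theorem heightOneSpectrumOfPrimesOver_asIdeal (P : Ideal (𝓞 K)) (hP : P ∈ v.asIdeal.primesOver (𝓞 K)) :
    (heightOneSpectrumOfPrimesOver v P hP).asIdeal = P := rfl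

omit [NumberField K] in
/-- `heightOneSpectrumOfPrimesOver` lies over `v`. -/
theorem liesOver_heightOneSpectrumOfPrimesOver (P : Ideal (𝓞 K)) (hP : P ∈ v.asIdeal.primesOver (𝓞 K)) :
    (heightOneSpectrumOfPrimesOver v P hP).asIdeal.LiesOver v.asIdeal := hP.2

omit [NumberField K] in
/-- Every height-one prime above `v` is in `primesOver`. -/
theorem asIdeal_mem_primesOver (w : HeightOneSpectrum (𝓞 K)) [w.asIdeal.LiesOver v.asIdeal] :
    w.asIdeal ∈ v.asIdeal.primesOver (𝓞 K) :=
  ⟨w.isPrime, inferInstance⟩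

end PrimesOver

section Dichotomy

variable (K : Type*) [Field K] [NumberField K] [IsCMField K]
variable (v : HeightOneSpectrum (𝓞 (maximalRealSubfield K)))
variable {θ : maximalRealSubfield K} {y : K}
variable (hθ : algebraMap (maximalRealSubfield K) K θ = y ^ 2) (hy : complexConj K y ≠ y)

include hθ hy in
/-- **THE FINITE-PLACE DICHOTOMY of the CM field `K / K⁺`:** for every finite place `v` of `K⁺`, either
(NON-SPLIT) there is exactly one prime `w` above `v`, `θ` is not a `v`-adic square, `[K_w : K⁺_v] = 2` and
`K⁺_v ⊗[K⁺] K ≃ₐ[K⁺_v] K_w`; or (SPLIT) there are two distinct primes `w ≠ w'` above `v` (and no other), `θ` is a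
`v`-adic square, `[K_w : K⁺_v] = [K_{w'} : K⁺_v] = 1` and `K⁺_v ⊗[K⁺] K ≃ₐ[K⁺_v] K_w × K_{w'}`. -/
theorem dichotomy :
    (∃ w : HeightOneSpectrum (𝓞 K), ∃ _ : w.asIdeal.LiesOver v.asIdeal,
        v.asIdeal.primesOver (𝓞 K) = {w.asIdeal} ∧
        ¬ IsSquare (algebraMap (maximalRealSubfield K) (v.adicCompletion (maximalRealSubfield K)) θ) ∧
        finrank (v.adicCompletion (maximalRealSubfield K)) (w.adicCompletion K) = 2 ∧
        Nonempty ((v.adicCompletion (maximalRealSubfield K)) ⊗[maximalRealSubfield K] K ≃ₐ[v.adicCompletion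
          (maximalRealSubfield K)] w.adicCompletion K)) ∨
    (∃ w w' : HeightOneSpectrum (𝓞 K), ∃ _ : w.asIdeal.LiesOver v.asIdeal, ∃ _ : w'.asIdeal.LiesOver v.asIdeal,
        w ≠ w' ∧ v.asIdeal.primesOver (𝓞 K) = {w.asIdeal, w'.asIdeal} ∧
        IsSquare (algebraMap (maximalRealSubfield K) (v.adicCompletion (maximalRealSubfield K)) θ) ∧
        finrank (v.adicCompletion (maximalRealSubfield K)) (w.adicCompletion K) = 1 ∧
        finrank (v.adicCompletion (maximalRealSubfield K)) (w'.adicCompletion K) = 1 ∧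
        Nonempty ((v.adicCompletion (maximalRealSubfield K)) ⊗[maximalRealSubfield K] K ≃ₐ[v.adicCompletion
          (maximalRealSubfield K)] (w.adicCompletion K × w'.adicCompletion K))) := by
  rcases ncard_primesOver_eq_one_or_two K v with h1 | h2
  · left
    obtain ⟨P, hP⟩ := Set.ncard_eq_one.mp h1
    have hPmem : P ∈ v.asIdeal.primesOver (𝓞 K) := by rw [hP]; exact Set.mem_singleton P
    let w := heightOneSpectrumOfPrimesOver v P hPmem
    haveI : w.asIdeal.LiesOver v.asIdeal := liesOver_heightOneSpectrumOfPrimesOver v P hPmem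
    have hsq := (ncard_primesOver_eq_one_iff_not_isSquare K v w hθ hy).mp h1
    refine ⟨w, inferInstance, hP, hsq, (T5FinitePlaceCM.finrank_eq_two_iff_not_isSquare K hθ hy v w).mpr hsq,
      ⟨tensorLiftEquivOfNotIsSquare v w hθ.symm (span_pair_eq_top K hy) hsq⟩⟩
  · right
    obtain ⟨P, P', hne, hP⟩ := Set.ncard_eq_two.mp h2
    have hPmem : P ∈ v.asIdeal.primesOver (𝓞 K) := by rw [hP]; exact Set.mem_insert P _
    have hP'mem : P' ∈ v.asIdeal.primesOver (𝓞 K) := by rw [hP]; exact Set.mem_insert_of_mem P rfl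
    let w := heightOneSpectrumOfPrimesOver v P hPmem
    let w' := heightOneSpectrumOfPrimesOver v P' hP'mem
    haveI : w.asIdeal.LiesOver v.asIdeal := liesOver_heightOneSpectrumOfPrimesOver v P hPmem
    haveI : w'.asIdeal.LiesOver v.asIdeal := liesOver_heightOneSpectrumOfPrimesOver v P' hP'mem
    have hne' : w ≠ w' := fun h => hne (congrArg HeightOneSpectrum.asIdeal h)
    have hsq := (ncard_primesOver_eq_two_iff_isSquare K v w hθ hy).mp h2
    refine ⟨w, w', inferInstance, inferInstance, hne', hP, hsq, finrank_eq_one_of_isSquare K hθ hy v w hsq,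
      finrank_eq_one_of_isSquare K hθ hy v w' hsq, ⟨prodLiftEquiv K v w w' hθ hy hne' hsq⟩⟩

end Dichotomy

end Summit.Ventures.HodgeRepro2.T5FinitePlaceDichotomy
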